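/-
Copyright: the b2b-balaban T⁴-continuum CRUX team, row NE7b leaf lineage `t4-ne7b-formalise-leaf-05` (gen 155). Project licence.
-/
import Mathlib.Algebra.Order.BigOperators.Group.List
import Mathlib.Algebra.BigOperators.Ring.List
import Mathlib.Algebra.BigOperators.Group.Finset.Defs
import Summits.QuantumFields.BalabanUV.T4Continuum.Spine.NE7b.LinearisedLatticeStokes
import Summits.QuantumFields.BalabanUV.T4Continuum.Spine.NE7b.NonAbelianStokesDisc

/-!
# THE LINEARISED LATTICE NON-ABELIAN STOKES IDENTITY WITH CURVATURE DEFECT, III — general discs: the scripts of `NonAbelianStokesDisc` read in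
# the semidirect product `N ⋊[φ] G` (row NE7b, node U5c; the (h1) slot of print's `γ₀` assembly — `HOME/b2b-balaban-r1/SectE-interface-proof.md`
# Lemma CS (i)–(ii), census §8.5; part I = `LinearisedLatticeStokes` (pair holonomy, gluing, ladder), part II = `LinearisedLatticeStokesRectangle`)

Cell `pub-balaban`, sub-cell `t4`, spine estimate NE7b (`T4WeightBudget.RelWeightBound`; the cell's OWN estimate — NOT PRINTED in [Bałaban 1983–89],
NOT PROVED).  Crux-route work under `Spine/NE7b/` by a row leaf; [folklore] lattice gauge algebra on ONE configuration; NOTHING of Bałaban's is named,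
asserted or valued; no `T4Continuum/Support` leaf typed; ONE data definition (`stages`, a list-valued function — no `Prop`-valued definition); zero `sorry`.
Imports: Mathlib (ordered list sums) + the BUILT `Spine/NE7b/LinearisedLatticeStokes` (part I: `right_hol`, `left_hol_glue_of_flat_comm`, `sz_glue_defect_le`
BY NAME) and `Spine/NE7b/NonAbelianStokesDisc` (leaf-01 g28: `Move`, `build`, `loops`, `glued`, `dist1_hol_build_le_sum` BY NAME).

WHY (located).  Part I proved the linearised gluing lemma for ONE inserted loop and the straight ladder in closed form; part II the coordinate rectangle.
Lemma CS (i) is stated for «the closed contour `∂S_x(P)`» of a unit square tiled by fine plaquettes — a rectangle — but its consumers ((ii): «fine paths …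
enclosing `O(d)` unit squares») and every other disc met in the cell (collars, `L`-shaped regions, boundaries of block unions) are GENERAL DISCS.  The
group-level file `NonAbelianStokesDisc` presents a disc by a SCRIPT of moves (insert a backtrack ∕ cancel one ∕ insert a closed word) and proves (NAS)
`dist1 V(build ms) ≤ Σ_{(y,σ) ∈ glued} dist1 V(σ; y)`.  THIS FILE reads the same scripts in `N ⋊[φ] G`: the `N`-part of the built word's pair holonomy
— the covariant boundary sum of the 1-form — equals the product of the TRANSPORTED linearised holonomies of the inserted loops EXACTLY when every
inserted loop is flat, and differs from it by a conjugation defect of size `≤ c · Σ_loops dist1 U(σ) × (budget)` in general; under a uniform budget the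
curvature sum is VERBATIM the right-hand side of the group-level (NAS).

WHAT IS PROVED ([folklore]):
* §0 DATA `stages ms` — for each loop move, the triple (prefix `α`, inserted word `σ`, word `w` it enters); `glued_eq_map_stages`, `loops_eq_map_stages`.
* §1 PAIR-LEVEL MOVES (any groups): `hol_build_backtrack` ∕ `hol_build_cancel` (backtracks are invisible to pair holonomy), `hol_build_loop` (the lasso
  factorisation `hol_glue` for pairs), `right_hol_build` (the `G`-part of a built word is its transport).
* §2 FLAT EXACTNESS (commutative `N`): **`left_hol_build_of_flat`** — if every inserted loop `σ` has `U(σ; x + disp α) = 1`, then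
  `(build ms).left = ∏_{(α,σ,w) ∈ stages} φ(U(α)) σ.left` (the transported linearised loop holonomies; for plaquette scripts: the transported covariant
  curls); `left_hol_build_of_flat'` (hypotheses in `loops` ∕ `glued` form).
* §3 THE DEFECT (`GaugeGroup G`, size letters of part I §3): **`sz_build_defect_le`** —
  `sz((build ms).left ∕ ∏ φ(U(α)) σ.left) ≤ c · Σ_{(α,σ,w) ∈ stages} dist1 U(σ; x + disp α) · (sz α.left + sz w.left)` (one `sz_glue_defect_le` per loop move;
  backtrack ∕ cancel moves cost nothing).
* §4 BUDGETS: **`sz_build_defect_le_of_budget`** — under `sz α.left + sz w.left ≤ B` at every stage, the defect is `≤ c · B · Σ_{(y,σ) ∈ glued x ms} dist1 U(σ; y)`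
  — the SAME curvature sum that bounds `dist1 U(build ms)` in `NonAbelianStokesDisc.dist1_hol_build_le_sum`; `sz_left_stepHol_le`, **`sz_left_hol_le_length_mul`**
  (`sz w.left ≤ |w| · a` from a bond letter `sz A(b) ≤ a` — the budget of (5.2)'s regime, where bond forms are `O(η · max|A|)`).
* §5 ORIENTATION: `left_hol_revWord_of_closed` (`(σ⁻¹).left = φ(U(σ)⁻¹) (σ.left)⁻¹`), `sz_left_hol_revWord_of_closed`; **`sz_build_defect_le_plaquettes`**
  (v7's form: for scripts inserting plaquette contours of either orientation the curvature sum is `Σ_p dist1 U(∂p)`).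
* §6 THE ADDITIVE END (`N = Multiplicative V`, `V` a seminormed group, the additive defect letter of part II §6): **`norm_build_sub_sum_le`** —
  `‖(build ms).left − Σ_{(α,σ,w)} φ(U(α)) σ.left‖ ≤ c · Σ dist1 U(σ) · (‖α.left‖ + ‖w.left‖)`.
* §7 SANITY: the stages of `NonAbelianStokesDisc.build_rect21`'s script of the `2 × 1` rectangle (two plaquette insertions, one cancelled backtrack).

NOT HERE (honest): which scripts present Bałaban's contours `∂S_x(P)` ∕ the (ii) comparison paths, the values of `ε_F`, `c_g`, the counting of (5.2)
(`CovariantStokesCounting`), (R-M), (R-V) — (A3) ∕ (A1c) territory, NC-NE7b-α UNRULED.  BY-NAME EFFECT ON THE WALL: NONE ((ℓ1)'s (h1) letter keeps its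
displayed `(p, q)`; the wall is (R2)).  NE7b NOT PRINTED ∕ NOT PROVED; spine PROVED 0∕9; rung (B)+1 on a FINITE torus — NOT infinite volume, NOT the mass
gap, NOT Clay.  HONEST DEPENDENCY: continuum YM on T⁴ ⇐ BetaPertH ∧ nine spine estimates (0/9 proved); BetaPertH ⇐ (D1) ∧ (D4) ∧ CAP+tail; G-an2-4
gates asym, D1 and NE2/3/4.
-/

set_option autoImplicit false

namespace Summit.QuantumFields.BalabanUV.T4Continuum.NE7b.LinearisedLatticeStokesDisc

open Literature.MathematicalPhysics.QuantumFieldTheory.Balaban1983to89 (GaugeGroup dist1)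
open Literature.MathematicalPhysics.QuantumFieldTheory.Balaban1983to89.B7Prop1Explicit
  (Site Letter disp disp_append disp_revWord stepHol stepHol_true stepHol_false hol hol_nil hol_cons hol_append revWord hol_revWord'
   plaqWord disp_plaqWord)
open NonAbelianStokesBound (hol_backtrack hol_glue)
open NonAbelianStokesDisc
open LinearisedLatticeStokes (aut_aut right_hol left_hol_glue_of_flat_comm sz_glue_defect_le sz_one_eq_zero)

variable {d : ℕ}

/-! ## §0 The stages of a script (DATA) -/

section Stages

/-- DATA.  The STAGES of a disc script `ms` (moves applied in list order, head LAST): for every loop move `Move.loop n σ` the triple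
`(α, σ, w)` with `w = build ms'` the word built by the earlier moves `ms'` and `α = w.take n` the prefix after which `σ` is inserted
(so the loop is read at the base point `x + disp α`, transported by `U(α)`).  Backtrack and cancel moves contribute no stage. -/
def stages : List (Move d) → List (List (Letter d) × List (Letter d) × List (Letter d))
  | [] => []
  | Move.backtrack _ _ :: ms => stages ms
  | Move.cancel _ _ :: ms => stages ms
  | Move.loop n σ :: ms => ((build ms).take n, σ, build ms) :: stages ms

/-- `stages` of the empty script. -/
@[simp] theorem stages_nil : stages ([] : List (Move d)) = [] := rfl

/-- A backtrack move adds no stage. -/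
@[simp] theorem stages_backtrack (n : ℕ) (l : Letter d) (ms : List (Move d)) :
    stages (Move.backtrack n l :: ms) = stages ms := rfl

/-- A cancel move adds no stage. -/
@[simp] theorem stages_cancel (n : ℕ) (l : Letter d) (ms : List (Move d)) :
    stages (Move.cancel n l :: ms) = stages ms := rfl

/-- A loop move adds the stage `(prefix, loop, word)`. -/
@[simp] theorem stages_loop (n : ℕ) (σ : List (Letter d)) (ms : List (Move d)) :
    stages (Move.loop n σ :: ms) = ((build ms).take n, σ, build ms) :: stages ms := rfl

/-- The inserted words of `NonAbelianStokesDisc.loops` are the middle components of the stages. -/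
theorem loops_eq_map_stages : ∀ ms : List (Move d), loops ms = (stages ms).map fun t => t.2.1
  | [] => rfl
  | Move.backtrack _ _ :: ms => by rw [stages_backtrack, ← loops_eq_map_stages ms]; rfl
  | Move.cancel _ _ :: ms => by rw [stages_cancel, ← loops_eq_map_stages ms]; rfl
  | Move.loop n σ :: ms => by rw [stages_loop, List.map_cons, ← loops_eq_map_stages ms]; rfl

/-- The glued loops of `NonAbelianStokesDisc.glued x` are the stages read at their base points `x + disp α`. -/
theorem glued_eq_map_stages (x : Site d) : ∀ ms : List (Move d), glued x ms = (stages ms).map fun t => (x + disp t.1, t.2.1)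
  | [] => rfl
  | Move.backtrack _ _ :: ms => by rw [stages_backtrack, ← glued_eq_map_stages x ms]; rfl
  | Move.cancel _ _ :: ms => by rw [stages_cancel, ← glued_eq_map_stages x ms]; rfl
  | Move.loop n σ :: ms => by rw [stages_loop, List.map_cons, ← glued_eq_map_stages x ms]; rfl

/-- A stage's loop is one of the script's inserted words. -/
theorem loop_mem_loops_of_mem_stages {ms : List (Move d)} {t : List (Letter d) × List (Letter d) × List (Letter d)}
    (ht : t ∈ stages ms) : t.2.1 ∈ loops ms := by
  rw [loops_eq_map_stages]; exact List.mem_map.mpr ⟨t, ht, rfl⟩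

/-- A stage's loop, read at its base point, is one of the script's glued loops. -/
theorem glued_mem_of_mem_stages (x : Site d) {ms : List (Move d)} {t : List (Letter d) × List (Letter d) × List (Letter d)}
    (ht : t ∈ stages ms) : (x + disp t.1, t.2.1) ∈ glued x ms := by
  rw [glued_eq_map_stages]; exact List.mem_map.mpr ⟨t, ht, rfl⟩

end Stages

/-! ## §1 Pair-level moves: backtracks are invisible, a loop move is a lasso factorisation -/

section PairMoves

variable {G N : Type*} [Group G] [Group N] {φ : G →* MulAut N}
variable (W : Site d → Fin d → N ⋊[φ] G) (U : Site d → Fin d → G)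

/-- **A BACKTRACK MOVE DOES NOT CHANGE THE PAIR HOLONOMY** (`hol_backtrack` holds in every group, in particular in `N ⋊[φ] G`). [folklore] -/
theorem hol_build_backtrack (x : Site d) (n : ℕ) (l : Letter d) (ms : List (Move d)) :
    hol W x (build (Move.backtrack n l :: ms)) = hol W x (build ms) := by
  rw [build_backtrack, hol_backtrack, List.take_append_drop]

/-- **A CANCEL MOVE DOES NOT CHANGE THE PAIR HOLONOMY** (when it fires the word WAS `prefix · l · l⁻¹ · suffix`). [folklore] -/
theorem hol_build_cancel (x : Site d) (n : ℕ) (l : Letter d) (ms : List (Move d)) :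
    hol W x (build (Move.cancel n l :: ms)) = hol W x (build ms) := by
  rw [build_cancel]
  split_ifs with hc
  · conv_rhs => rw [eq_backtrack_of_take_two hc]
    rw [hol_backtrack]
  · rfl

/-- **A LOOP MOVE IS A LASSO FACTORISATION** at pair level: inserting the closed word `σ` after the prefix `α = w.take n` multiplies the pair
holonomy on the left by the pair lasso `(α)(σ)(α)⁻¹` (`hol_glue` read in `N ⋊[φ] G`). [folklore] -/
theorem hol_build_loop (x : Site d) (n : ℕ) (σ : List (Letter d)) (ms : List (Move d)) (hσ : disp σ = 0) :
    hol W x (build (Move.loop n σ :: ms)) =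
      hol W x ((build ms).take n) * hol W (x + disp ((build ms).take n)) σ * (hol W x ((build ms).take n))⁻¹ * hol W x (build ms) := by
  rw [build_loop, hol_glue W x _ σ _ hσ, List.take_append_drop]

/-- The `G`-part of a built word's pair holonomy is its transport. [folklore] -/
theorem right_hol_build (hU : ∀ y k, (W y k).right = U y k) (x : Site d) (ms : List (Move d)) :
    (hol W x (build ms)).right = hol U x (build ms) :=
  right_hol W U hU x _

end PairMoves

/-! ## §2 Flat exactness: flat inserted loops telescope into the product of their transported linearised holonomies -/

section Flat

variable {G N : Type*} [Group G] [CommGroup N] {φ : G →* MulAut N}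
variable (W : Site d → Fin d → N ⋊[φ] G) (U : Site d → Fin d → G)

/-- **THE LINEARISED STOKES IDENTITY FOR A FLAT DISC SCRIPT** (commutative `N`, e.g. `Multiplicative 𝔤`).  If every inserted word is closed and
has trivial transport at its base point, `U(σ; x + disp α) = 1`, then the `N`-part of the built word's pair holonomy is EXACTLY the product over the
stages of the transported linearised loop holonomies `φ(U(α)) σ.left` — for plaquette scripts: the covariant boundary sum of the 1-form equals the sum
of the transported covariant curls (Lemma CS (i) for a general disc, at flat background). [folklore] -/
theorem left_hol_build_of_flat (hU : ∀ y k, (W y k).right = U y k) (x : Site d) :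
    ∀ ms : List (Move d), (∀ t ∈ stages ms, disp t.2.1 = 0) → (∀ t ∈ stages ms, hol U (x + disp t.1) t.2.1 = 1) →
      (hol W x (build ms)).left = ((stages ms).map fun t => φ (hol U x t.1) (hol W (x + disp t.1) t.2.1).left).prod
  | [], _, _ => by simp [build]
  | Move.backtrack n l :: ms, hcl, hfl => by
    rw [hol_build_backtrack, stages_backtrack]
    exact left_hol_build_of_flat hU x ms (fun t ht => hcl t (by simpa using ht)) (fun t ht => hfl t (by simpa using ht))
  | Move.cancel n l :: ms, hcl, hfl => by
    rw [hol_build_cancel, stages_cancel]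
    exact left_hol_build_of_flat hU x ms (fun t ht => hcl t (by simpa using ht)) (fun t ht => hfl t (by simpa using ht))
  | Move.loop n σ :: ms, hcl, hfl => by
    have hmem : ((build ms).take n, σ, build ms) ∈ stages (Move.loop n σ :: ms) := by simp
    have ih := left_hol_build_of_flat hU x ms (fun t ht => hcl t (by simp [ht])) (fun t ht => hfl t (by simp [ht]))
    have key := left_hol_glue_of_flat_comm W U hU x ((build ms).take n) σ ((build ms).drop n) (hcl _ hmem) (hfl _ hmem)
    rw [List.take_append_drop] at key
    rw [stages_loop, List.map_cons, List.prod_cons, build_loop, key, ih]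

/-- The same identity with the hypotheses in `NonAbelianStokesDisc`'s vocabulary: inserted words closed (`loops`), glued loops flat (`glued`). [folklore] -/
theorem left_hol_build_of_flat' (hU : ∀ y k, (W y k).right = U y k) (x : Site d) (ms : List (Move d))
    (hcl : ∀ σ ∈ loops ms, disp σ = 0) (hfl : ∀ q ∈ glued x ms, hol U q.1 q.2 = 1) :
    (hol W x (build ms)).left = ((stages ms).map fun t => φ (hol U x t.1) (hol W (x + disp t.1) t.2.1).left).prod :=
  left_hol_build_of_flat W U hU x ms (fun _ ht => hcl _ (loop_mem_loops_of_mem_stages ht))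
    (fun _ ht => hfl _ (glued_mem_of_mem_stages x ht))

end Flat

/-! ## §3 The curvature defect of a general disc script -/

section Defect

variable {G N : Type*} [GaugeGroup G] [CommGroup N] {φ : G →* MulAut N}
variable (W : Site d → Fin d → N ⋊[φ] G) (U : Site d → Fin d → G)

/-- Bookkeeping in a commutative group: the new quotient is (this step's gluing defect) × (the old quotient). [folklore] -/
theorem quotient_step (T S F Wl : N) : T * (S * F)⁻¹ = T * (S * Wl)⁻¹ * (Wl * F⁻¹) := by
  apply Additive.ofMul.injective; simp only [ofMul_mul, ofMul_inv]; abel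

/-- **THE LINEARISED STOKES ESTIMATE FOR A GENERAL DISC SCRIPT WITH CURVATURE.**  Under the size letters of part I §3 (`sz` nonnegative, subadditive,
inversion-invariant; conjugation defect `sz(φ(g)a · a⁻¹) ≤ c · dist1 g · sz a`), for a script whose inserted words are closed, the `N`-part of the built
word's pair holonomy differs from the flat formula `∏_{(α,σ,w)} φ(U(α)) σ.left` by an element of size
`≤ c · Σ_{(α,σ,w) ∈ stages} dist1 U(σ; x + disp α) · (sz α.left + sz w.left)`:
one gluing defect (`sz_glue_defect_le`) per loop move — the lasso costs what the loop costs — and NOTHING for backtrack ∕ cancel moves. [folklore] -/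
theorem sz_build_defect_le (hU : ∀ y k, (W y k).right = U y k) (sz : N → ℝ) {c : ℝ} (h0 : ∀ a, 0 ≤ sz a)
    (hmul : ∀ a b, sz (a * b) ≤ sz a + sz b) (hinv : ∀ a, sz a⁻¹ = sz a)
    (hdef : ∀ (g : G) (a : N), sz (φ g a * a⁻¹) ≤ c * dist1 g * sz a) (x : Site d) :
    ∀ ms : List (Move d), (∀ t ∈ stages ms, disp t.2.1 = 0) →
      sz ((hol W x (build ms)).left *
          (((stages ms).map fun t => φ (hol U x t.1) (hol W (x + disp t.1) t.2.1).left).prod)⁻¹)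
        ≤ c * ((stages ms).map fun t =>
            dist1 (hol U (x + disp t.1) t.2.1) * (sz (hol W x t.1).left + sz (hol W x t.2.2).left)).sum
  | [], _ => by
    simp only [build, hol_nil, SemidirectProduct.one_left, stages_nil, List.map_nil, List.prod_nil, inv_one, mul_one,
      List.sum_nil, mul_zero]
    exact le_of_eq (sz_one_eq_zero sz h0 hdef)
  | Move.backtrack n l :: ms, hcl => by
    rw [hol_build_backtrack, stages_backtrack]
    exact sz_build_defect_le hU sz h0 hmul hinv hdef x ms (fun t ht => hcl t (by simpa using ht))
  | Move.cancel n l :: ms, hcl => by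
    rw [hol_build_cancel, stages_cancel]
    exact sz_build_defect_le hU sz h0 hmul hinv hdef x ms (fun t ht => hcl t (by simpa using ht))
  | Move.loop n σ :: ms, hcl => by
    have hmem : ((build ms).take n, σ, build ms) ∈ stages (Move.loop n σ :: ms) := by simp
    have ih := sz_build_defect_le hU sz h0 hmul hinv hdef x ms (fun t ht => hcl t (by simp [ht]))
    have step := sz_glue_defect_le W U hU sz hmul hinv hdef x ((build ms).take n) σ ((build ms).drop n) (hcl _ hmem)
    rw [List.take_append_drop] at step
    rw [stages_loop, List.map_cons, List.prod_cons, List.map_cons, List.sum_cons, build_loop, mul_add, quotient_step]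
    exact (hmul _ _).trans (add_le_add (by simpa only [mul_assoc] using step) ih)

end Defect

/-! ## §4 Budgets: a uniform stage budget turns the defect into `c · B ×` the curvature sum of the group-level (NAS) -/

section Budget

variable {G N : Type*} [GaugeGroup G] [CommGroup N] {φ : G →* MulAut N}
variable (W : Site d → Fin d → N ⋊[φ] G) (U : Site d → Fin d → G)

/-- **THE DEFECT UNDER A UNIFORM BUDGET.**  If at every stage `sz α.left + sz w.left ≤ B`, then
`sz((build ms).left ∕ flat formula) ≤ c · B · Σ_{(y,σ) ∈ glued x ms} dist1 U(σ; y)` — the curvature sum on the right is VERBATIM the bound of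
`NonAbelianStokesDisc.dist1_hol_build_le_sum` on `dist1 U(build ms)`: one datum prices both the transport and the linearised defect. [folklore] -/
theorem sz_build_defect_le_of_budget (hU : ∀ y k, (W y k).right = U y k) (sz : N → ℝ) {c B : ℝ} (hc : 0 ≤ c)
    (h0 : ∀ a, 0 ≤ sz a) (hmul : ∀ a b, sz (a * b) ≤ sz a + sz b) (hinv : ∀ a, sz a⁻¹ = sz a)
    (hdef : ∀ (g : G) (a : N), sz (φ g a * a⁻¹) ≤ c * dist1 g * sz a) (x : Site d) (ms : List (Move d))
    (hcl : ∀ σ ∈ loops ms, disp σ = 0) (hB : ∀ t ∈ stages ms, sz (hol W x t.1).left + sz (hol W x t.2.2).left ≤ B) :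
    sz ((hol W x (build ms)).left *
        (((stages ms).map fun t => φ (hol U x t.1) (hol W (x + disp t.1) t.2.1).left).prod)⁻¹)
      ≤ c * B * ((glued x ms).map fun q => dist1 (hol U q.1 q.2)).sum := by
  have h := sz_build_defect_le W U hU sz h0 hmul hinv hdef x ms (fun _ ht => hcl _ (loop_mem_loops_of_mem_stages ht))
  refine h.trans ?_
  rw [glued_eq_map_stages, List.map_map, mul_assoc]
  refine mul_le_mul_of_nonneg_left ?_ hc
  rw [← List.sum_map_mul_left]
  refine List.sum_le_sum fun t ht => ?_
  simp only [Function.comp_apply]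
  rw [mul_comm B]
  exact mul_le_mul_of_nonneg_left (hB t ht) (GaugeGroup.dist1_nonneg _)

variable {U}

/-- A bond letter bounds the `N`-part of a one-letter transport in either orientation (`A(b⁻¹) = φ(U(b)⁻¹) A(b)⁻¹` has the size of `A(b)`). [folklore] -/
theorem sz_left_stepHol_le (sz : N → ℝ) (hinv : ∀ a, sz a⁻¹ = sz a) (hiso : ∀ (g : G) (a : N), sz (φ g a) = sz a)
    {a : ℝ} (ha : ∀ y k, sz (W y k).left ≤ a) (x : Site d) (l : Letter d) : sz (stepHol W x l).left ≤ a := by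
  obtain ⟨μ, b⟩ := l
  cases b
  · rw [stepHol_false, SemidirectProduct.inv_left, hiso, hinv]; exact ha _ _
  · rw [stepHol_true]; exact ha _ _

/-- **THE WORD BUDGET**: under a bond letter `sz A(b) ≤ a` (and `φ` `sz`-isometric), `sz (w).left ≤ |w| · a` for every word `w` — the budget `B` of
`sz_build_defect_le_of_budget` is at most `2 · (longest intermediate word) · a`. [folklore] -/
theorem sz_left_hol_le_length_mul (sz : N → ℝ) (h1 : sz 1 = 0) (hmul : ∀ a b, sz (a * b) ≤ sz a + sz b) (hinv : ∀ a, sz a⁻¹ = sz a)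
    (hiso : ∀ (g : G) (a : N), sz (φ g a) = sz a) {a : ℝ} (ha : ∀ y k, sz (W y k).left ≤ a) :
    ∀ (x : Site d) (w : List (Letter d)), sz (hol W x w).left ≤ w.length * a
  | x, [] => by rw [hol_nil, SemidirectProduct.one_left, h1, List.length_nil, Nat.cast_zero, zero_mul]
  | x, l :: w => by
    have hstep := sz_left_stepHol_le W sz hinv hiso ha x l
    have hrest := sz_left_hol_le_length_mul sz h1 hmul hinv hiso ha (x + l.vec) w
    rw [hol_cons, SemidirectProduct.mul_left, List.length_cons, Nat.cast_succ]
    refine (hmul _ _).trans ?_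
    rw [hiso]
    linarith

end Budget

/-! ## §5 Orientation: reversed loops, and v7's plaquette form of the curvature sum -/

section Orientation

variable {G N : Type*} [Group G] [Group N] {φ : G →* MulAut N}
variable (W : Site d → Fin d → N ⋊[φ] G) (U : Site d → Fin d → G)

/-- **A CLOSED LOOP READ BACKWARDS**: `(σ⁻¹).left = φ(U(σ)⁻¹) (σ.left)⁻¹` (pair level `hol W y σ⁻¹ = (hol W y σ)⁻¹`); at flat `U(σ) = 1` the reversed
loop carries exactly the inverse linearised holonomy. [folklore] -/
theorem left_hol_revWord_of_closed (hU : ∀ y k, (W y k).right = U y k) (y : Site d) (σ : List (Letter d)) (hσ : disp σ = 0) :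
    (hol W y (revWord σ)).left = φ (hol U y σ)⁻¹ ((hol W y σ).left)⁻¹ := by
  rw [hol_revWord' W y σ (by rw [hσ, add_zero]), SemidirectProduct.inv_left, right_hol W U hU]

/-- … hence it has the same size under the letters (`φ` isometric, inversion invariant). [folklore] -/
theorem sz_left_hol_revWord_of_closed (hU : ∀ y k, (W y k).right = U y k) (sz : N → ℝ) (hinv : ∀ a, sz a⁻¹ = sz a)
    (hiso : ∀ (g : G) (a : N), sz (φ g a) = sz a) (y : Site d) (σ : List (Letter d)) (hσ : disp σ = 0) :
    sz (hol W y (revWord σ)).left = sz (hol W y σ).left := by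
  rw [left_hol_revWord_of_closed W U hU y σ hσ, hiso, hinv]

end Orientation

section Plaquettes

variable {G N : Type*} [GaugeGroup G] [CommGroup N] {φ : G →* MulAut N}
variable (W : Site d → Fin d → N ⋊[φ] G) (U : Site d → Fin d → G)

/-- **v7's FORM FOR DISCS OF PLAQUETTES.**  If every word inserted by the script is a plaquette contour `plaqWord κ μ` or its reverse (orientation free,
`pl` names the plaquette of each glued loop), then under the stage budget `B` the linearised defect is `≤ c · B · Σ_p dist1 U(∂p)` — the plaquette sum
of `NonAbelianStokesDisc.dist1_hol_build_le_sum_plaquettes`. [folklore] -/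
theorem sz_build_defect_le_plaquettes (hU : ∀ y k, (W y k).right = U y k) (sz : N → ℝ) {c B : ℝ} (hc : 0 ≤ c)
    (h0 : ∀ a, 0 ≤ sz a) (hmul : ∀ a b, sz (a * b) ≤ sz a + sz b) (hinv : ∀ a, sz a⁻¹ = sz a)
    (hdef : ∀ (g : G) (a : N), sz (φ g a * a⁻¹) ≤ c * dist1 g * sz a) (x : Site d) (ms : List (Move d))
    (pl : ((Site d) × List (Letter d)) → Fin d × Fin d)
    (hpl : ∀ q ∈ glued x ms, q.2 = plaqWord (pl q).1 (pl q).2 ∨ q.2 = revWord (plaqWord (pl q).1 (pl q).2))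
    (hB : ∀ t ∈ stages ms, sz (hol W x t.1).left + sz (hol W x t.2.2).left ≤ B) :
    sz ((hol W x (build ms)).left *
        (((stages ms).map fun t => φ (hol U x t.1) (hol W (x + disp t.1) t.2.1).left).prod)⁻¹)
      ≤ c * B * ((glued x ms).map fun q => dist1 (hol U q.1 (plaqWord (pl q).1 (pl q).2))).sum := by
  have hcl : ∀ σ ∈ loops ms, disp σ = 0 := by
    intro σ hσ
    rw [loops_eq_map_stages] at hσ
    obtain ⟨t, ht, rfl⟩ := List.mem_map.mp hσ
    rcases hpl _ (glued_mem_of_mem_stages x ht) with h | h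
    · simp only at h; rw [h, disp_plaqWord]
    · simp only at h; rw [h, disp_revWord, disp_plaqWord, neg_zero]
  refine (sz_build_defect_le_of_budget W U hU sz hc h0 hmul hinv hdef x ms hcl hB).trans (le_of_eq ?_)
  refine congrArg (c * B * ·) (congrArg List.sum (List.map_congr_left fun q hq => ?_))
  rcases hpl q hq with hq' | hq'
  · rw [hq']
  · rw [hq', dist1_hol_revWord_of_closed U q.1 _ (disp_plaqWord _ _)]

end Plaquettes

/-! ## §6 The additive END: `N = Multiplicative V`, the two additive letters -/

section Additive

variable {G : Type*} [GaugeGroup G] {V : Type*} [SeminormedAddCommGroup V] {φ : G →* MulAut (Multiplicative V)}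
variable (W : Site d → Fin d → Multiplicative V ⋊[φ] G) (U : Site d → Fin d → G)

/-- **THE END IN NORMED LETTERS.**  For `N = Multiplicative V` (`V` a seminormed additive group, e.g. `𝔤` with `φ = Ad`) and the ONE additive letter
«`‖φ(g)v − v‖ ≤ c · dist1 g · ‖v‖`» (`c = 2` for `Ad` on the cell's `U(n)`, `LinearisedLatticeStokesUnitary`; the isometry letter is not needed here — it
enters only the budgets of §4), the estimate `sz_build_defect_le` reads: the covariant boundary sum of the 1-form along ANY scripted disc boundary equals
the sum of the transported linearised loop holonomies up to `c · Σ_loops dist1 U(σ) · (‖α.left‖ + ‖w.left‖)`. [folklore] -/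
theorem norm_build_sub_sum_le (hU : ∀ y k, (W y k).right = U y k) {c : ℝ}
    (hdef : ∀ (g : G) (a : Multiplicative V), ‖(φ g a).toAdd - a.toAdd‖ ≤ c * dist1 g * ‖a.toAdd‖)
    (x : Site d) (ms : List (Move d)) (hcl : ∀ σ ∈ loops ms, disp σ = 0) :
    ‖((hol W x (build ms)).left).toAdd -
        ((stages ms).map fun t => (φ (hol U x t.1) (hol W (x + disp t.1) t.2.1).left).toAdd).sum‖
      ≤ c * ((stages ms).map fun t =>
          dist1 (hol U (x + disp t.1) t.2.1) * (‖((hol W x t.1).left).toAdd‖ + ‖((hol W x t.2.2).left).toAdd‖)).sum := by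
  have h := sz_build_defect_le W U hU (fun a => ‖a.toAdd‖) (fun a => norm_nonneg _)
    (fun a b => by rw [toAdd_mul]; exact norm_add_le _ _) (fun a => by rw [toAdd_inv, norm_neg]) (fun g a => by
      rw [toAdd_mul, toAdd_inv, ← sub_eq_add_neg]; exact hdef g a) x ms
    (fun _ ht => hcl _ (loop_mem_loops_of_mem_stages ht))
  simp only [toAdd_mul, toAdd_inv, toAdd_list_sum, List.map_map, ← sub_eq_add_neg] at h
  exact h

end Additive

/-! ## §7 Sanity: the stages of the `2 × 1` rectangle script of `NonAbelianStokesDisc.build_rect21` -/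

section Sanity

/-- The `2 × 1` rectangle script (glue `∂p(x)`, glue `∂p(x + e_κ)` after the first letter, cancel the backtrack) has exactly TWO stages: the second
plaquette is inserted after the prefix `[+e_κ]` into `∂p(x)`, the first into the empty word; the cancel move adds none. -/
example (κ μ : Fin d) :
    stages [Move.cancel 4 (μ, false), Move.loop 1 (plaqWord κ μ), Move.loop 0 (plaqWord κ μ)] =
      [([((κ, true) : Letter d)], plaqWord κ μ, plaqWord κ μ), ([], plaqWord κ μ, [])] := by
  simp [stages, build, Move.apply, plaqWord, List.take]

end Sanity

end Summit.QuantumFields.BalabanUV.T4Continuum.NE7b.LinearisedLatticeStokesDisc
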